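import Mathlib
import HarnessLib
import Summits.NavierStokesRegularity.NavierStokesRegularity.Theorems.TypeILiouvilleShorelineContinuation
import Summits.NavierStokesRegularity.NavierStokesRegularity.Theorems.ExtremiserTransienceNearExtremalTransiencePerFlowAxisymmetricTypeILiouville
import Literature.Analysis.FluidPDE.AxisymmetricReflection

/-!
# TypeILiouvilleTypeIDoorLocalAxis — crux (L) stmt-NavierStokesRegularity-10661 `TypeIliouvilleL`, registered stub
# `stub_typeIAncientLiouville_knssGauge` (= door stmt-4050): A TYPE-I PROFILE WITH ONE LOCALLY AXISYMMETRIC PATCH IS ZERO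

Helper for stmt-NavierStokesRegularity-10661 (`--supports`); theorems only, no definitions, no named-fact hypotheses;
closes no item; Navier–Stokes regularity is NOT proved here (leafhand seat of the EulerZoomLiouville route).

The ONLY stub of the (L) skeleton consumed by the route's summit chain is L' = `stub_typeIAncientLiouville_knssGauge`
(verbatim door stmt-4050: KNSS-gauge Type-I ancient mild fields `IsTypeIAncientMild C u` vanish).  Its axisymmetric
cell is CLOSED in the tree with swirl allowed and for ONE axisymmetric slice about any axis
(`NearExtremalTransiencePerFlow.FilamentSelection.eq_zero_of_isAxisymmetric_oneSlice` / `…_conj_…`, from the closed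
crux `AxisymEndLiouville` stmt-14061).  This file LOCALIZES the symmetry certificate to ONE OPEN PATCH of one slice:

* §1 `typeI_shift_classP` — the backward time-shift `t ↦ u(t − δ)` (`δ > 0`) of a KNSS-gauge Type-I field is in
  print's class P (continuous, bounded by `C/√δ`, Oseen-mild), so the class-P one-patch determination applies;
  `typeI_isAxisymmetric_slice_of_locally` — coincidence with all rotated twins `R_θ (u τ₁ (R_θ⁻¹ x))` on one nonempty
  open set of the slice `τ₁ < 0` makes that slice axisymmetric (`classP_symmetric_of_locally_symmetric` on the shift).
* §2 `typeI_eq_zero_of_locally_axisymmetric` — **a KNSS-gauge Type-I ancient mild field which, on ONE nonempty open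
  patch of ONE slice, coincides with all its rotated twins about the axis vanishes identically** (swirl allowed);
  `typeI_eq_zero_of_locally_axisymmetric_anyAxis` — about any line `{L(s e₃) + b}`;
  `typeIAncientLiouville_onLocalAxis` — the reading on the binders of stmt-4050 / the registered stub VERBATIM.

READING: the open core of the load-bearing door (rate window `C ≥ 1`, `typeIAncientLiouville_iff_core`) consists of
Type-I profiles with NO rotationally symmetric patch on any slice about any axis.
[cite: KochNadirashviliSereginSverak2009, Thm 5.2–5.3 and p. 10, §4 (arXiv:0709.3599); SereginSverak2009, Thm 1.1;
LemarieRieusset2016, Thm. 9.12 (PDF p. 260)]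
-/

noncomputable section

open MeasureTheory Filter Set Function Metric
open scoped Topology
open Literature.Analysis Literature.Analysis.FluidPDE Literature.Analysis.UnboundedOperators
open Summit.NavierStokesRegularity.NavierStokesRegularity.Theorems.TypeILiouvilleShoreline
open Summit.NavierStokesRegularity.NavierStokesRegularity.Theorems.NearExtremalTransiencePerFlow.FilamentSelection

set_option linter.dupNamespace false

namespace Summit.NavierStokesRegularity.NavierStokesRegularity.Theorems.TypeILiouvilleTypeIDoorLocalAxis

variable {K : ℝ} {W : ℝ → EuclideanSpace ℝ (Fin 3) → EuclideanSpace ℝ (Fin 3)}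

/-! ## §1 The backward shift of a Type-I field is in class P; local ⟹ slice symmetry -/

/-- **The backward time-shift `t ↦ u(t − δ)`, `δ > 0`, of a KNSS-gauge Type-I ancient mild field is in print's class P**:
continuous on the slab, bounded by `C/√δ`, and Oseen-mild between all pairs of negative times
(`IsTypeIAncientMild.comp_sub_right`, `.mild_eq_heatExtension`). [cite: KochNadirashviliSereginSverak2009, §4 (i) (arXiv:0709.3599 p. 8)] -/
theorem typeI_shift_classP (hW : IsTypeIAncientMild K W) {δ : ℝ} (hδ : 0 < δ) :
    ContinuousOn (uncurry fun t x => W (t - δ) x) (Iio 0 ×ˢ univ) ∧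
    (∃ K' : ℝ, ∀ t < 0, ∀ x, ‖W (t - δ) x‖ ≤ K') ∧
    (∀ s t : ℝ, s < t → t < 0 → ∀ x,
      W (t - δ) x = heatExtension (W (s - δ)) (t - s) x -
        oseenDuhamel 1 s (fun τ x => W (τ - δ) x) (fun τ x => W (τ - δ) x) t x) := by
  have hV : IsTypeIAncientMild K (fun t => W (t - δ)) := hW.comp_sub_right hδ.le
  refine ⟨hV.continuousOn_uncurry, ⟨K / Real.sqrt δ, fun t ht x => ?_⟩, fun s t hst ht x => ?_⟩
  · have h := hW.norm_le (t := t - δ) (by linarith) x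
    refine h.trans (div_le_div_of_nonneg_left hW.nonneg (Real.sqrt_pos.2 hδ) (Real.sqrt_le_sqrt (by linarith)))
  · exact hV.mild_eq_heatExtension hst ht x

/-- **LOCAL ROTATIONAL SYMMETRY OF ONE SLICE OF A TYPE-I FIELD IS SYMMETRY OF THAT SLICE.**  If `u τ₁` (`τ₁ < 0`)
coincides with each rotated twin `R_θ (u τ₁ (R_θ⁻¹ x))` on ONE nonempty open set, then `u τ₁` is axisymmetric (class-P
one-patch determination `classP_symmetric_of_locally_symmetric` applied to the shift by `δ = −τ₁/2`).
[cite: LemarieRieusset2016, Thm. 9.12 (PDF p. 260)] -/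
theorem typeI_isAxisymmetric_slice_of_locally (hW : IsTypeIAncientMild K W)
    {τ₁ : ℝ} (hτ₁ : τ₁ < 0) {U : Set (EuclideanSpace ℝ (Fin 3))} (hUo : IsOpen U) (hUne : U.Nonempty)
    (hrot : ∀ θ : ℝ, ∀ x ∈ U, W τ₁ x = rotZLIE θ (W τ₁ ((rotZLIE θ).symm x))) :
    IsAxisymmetric (W τ₁) := by
  set δ : ℝ := -τ₁ / 2 with hδ_def
  have hδ : 0 < δ := by rw [hδ_def]; linarith
  obtain ⟨hc, hK, hm⟩ := typeI_shift_classP hW hδ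
  have ht₀ : τ₁ + δ < 0 := by rw [hδ_def]; linarith
  rw [isAxisymmetric_iff_conj_rotZLIE]
  intro θ x
  have hloc : ∀ y ∈ U, (fun t x => W (t - δ) x) (τ₁ + δ) y =
      rotZLIE θ ((fun t x => W (t - δ) x) (τ₁ + δ) ((rotZLIE θ).symm y)) := by
    intro y hy
    simp only [add_sub_cancel_right]
    exact hrot θ y hy
  have h := classP_symmetric_of_locally_symmetric hc hK hm (rotZLIE θ) ht₀ hUo hUne hloc (τ₁ + δ) ht₀ x
  simp only [add_sub_cancel_right] at h
  exact h.symm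

/-! ## §2 The localized axisymmetric cell of the Type-I door -/

/-- **A KNSS-GAUGE TYPE-I ANCIENT MILD FIELD WITH ONE LOCALLY AXISYMMETRIC PATCH VANISHES** (swirl allowed): §1 and the
tree's one-slice axisymmetric Type-I Liouville theorem `eq_zero_of_isAxisymmetric_oneSlice` (closed crux
`AxisymEndLiouville`, stmt-14061: weighted swirl maximum principle + KNSS Thm 5.2).
[cite: KochNadirashviliSereginSverak2009, Thm 5.2 and p. 10 (arXiv:0709.3599); SereginSverak2009, Thm 1.1] -/
theorem typeI_eq_zero_of_locally_axisymmetric (hW : IsTypeIAncientMild K W)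
    {τ₁ : ℝ} (hτ₁ : τ₁ < 0) {U : Set (EuclideanSpace ℝ (Fin 3))} (hUo : IsOpen U) (hUne : U.Nonempty)
    (hrot : ∀ θ : ℝ, ∀ x ∈ U, W τ₁ x = rotZLIE θ (W τ₁ ((rotZLIE θ).symm x))) :
    ∀ τ : ℝ, τ < 0 → ∀ x, W τ x = 0 :=
  eq_zero_of_isAxisymmetric_oneSlice hW hτ₁ (typeI_isAxisymmetric_slice_of_locally hW hτ₁ hUo hUne hrot)

/-- **Any axis.**  With `L` a linear isometry of `ℝ³` and `b ∈ ℝ³`, read `u` in the frame in which the line `{L(s e₃) + b}`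
is the axis: `w t x = L⁻¹ (u t (L x + b))` (again a Type-I field, `isTypeIAncientMild_conj_affine`).  If ONE slice of `w`
coincides with all its rotated twins on ONE nonempty open set, then `u ≡ 0`.
[cite: KochNadirashviliSereginSverak2009, §1 p. 3 and Thm 5.2 (arXiv:0709.3599)] -/
theorem typeI_eq_zero_of_locally_axisymmetric_anyAxis (hW : IsTypeIAncientMild K W)
    (L : EuclideanSpace ℝ (Fin 3) ≃ₗᵢ[ℝ] EuclideanSpace ℝ (Fin 3)) (b : EuclideanSpace ℝ (Fin 3))
    {τ₁ : ℝ} (hτ₁ : τ₁ < 0) {U : Set (EuclideanSpace ℝ (Fin 3))} (hUo : IsOpen U) (hUne : U.Nonempty)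
    (hrot : ∀ θ : ℝ, ∀ x ∈ U,
      L.symm (W τ₁ (L x + b)) = rotZLIE θ (L.symm (W τ₁ (L ((rotZLIE θ).symm x) + b)))) :
    ∀ τ : ℝ, τ < 0 → ∀ x, W τ x = 0 :=
  eq_zero_of_conj_isAxisymmetric_oneSlice hW L b hτ₁
    (typeI_isAxisymmetric_slice_of_locally (W := fun t x => L.symm (W t (L x + b)))
      (isTypeIAncientMild_conj_affine hW L b) hτ₁ hUo hUne hrot)

/-- **Reading on the door / the registered stub VERBATIM.**  With the binders of
`Theses.SymmetryModuliCount.TypeIAncientLiouville` (stmt-4050) = `stub_typeIAncientLiouville_knssGauge` of the (L)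
skeleton: a smooth, divergence-free, Oseen-kernel-mild, Type-I-in-time field one of whose slices is, in some Euclidean
frame, rotationally symmetric on one nonempty open patch, vanishes identically.
[cite: KochNadirashviliSereginSverak2009, Thm 5.2 and p. 10 (arXiv:0709.3599); SereginSverak2009, Thm 1.1] -/
theorem typeIAncientLiouville_onLocalAxis :
    ∀ (C : ℝ) (u : ℝ → EuclideanSpace ℝ (Fin 3) → EuclideanSpace ℝ (Fin 3)),
      ContDiffOn ℝ (⊤ : ℕ∞) (Function.uncurry u) (Set.Iio 0 ×ˢ Set.univ) ∧
      (∀ t < 0, Literature.Analysis.FluidPDE.VectorCalculus.IsDivFree (u t)) ∧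
      (∀ s t : ℝ, s < t → t < 0 → ∀ x,
        u t x = Literature.Analysis.FluidPDE.heatFlow (u s) (t - s) x -
          ∫ τ in Set.Ioo s t, ∫ y,
            Literature.Analysis.FluidPDE.oseenKernel (t - τ) (x - y) (u τ y) (u τ y)) ∧
      Literature.Analysis.FluidPDE.HasTypeITimeDecay C u →
      (∃ (L : EuclideanSpace ℝ (Fin 3) ≃ₗᵢ[ℝ] EuclideanSpace ℝ (Fin 3)) (b : EuclideanSpace ℝ (Fin 3))
          (τ₁ : ℝ) (U : Set (EuclideanSpace ℝ (Fin 3))), τ₁ < 0 ∧ IsOpen U ∧ U.Nonempty ∧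
          ∀ θ : ℝ, ∀ x ∈ U,
            L.symm (u τ₁ (L x + b)) = rotZLIE θ (L.symm (u τ₁ (L ((rotZLIE θ).symm x) + b)))) →
      ∀ t < 0, ∀ x, u t x = 0 := by
  intro C u hu hloc
  obtain ⟨L, b, τ₁, U, hτ₁, hUo, hUne, hrot⟩ := hloc
  exact typeI_eq_zero_of_locally_axisymmetric_anyAxis (isTypeIAncientMild_iff.2 hu) L b hτ₁ hUo hUne hrot

end Summit.NavierStokesRegularity.NavierStokesRegularity.Theorems.TypeILiouvilleTypeIDoorLocalAxis

end
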